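import Mathlib
import Summits.MatrixMultiplication.MatrixMultiplication.Theses.ProbeRankScaling
import Summits.MatrixMultiplication.MatrixMultiplication.Theorems.ProbeRankScalingHalfScaleTransfer

-- single-conjunct summit: the mandated namespace `Summit.MatrixMultiplication.MatrixMultiplication.…`
-- repeats the summit name by design (D-0017), which the `dupNamespace` linter would flag.
set_option linter.dupNamespace false

/-!
# `ProbeRankScaling.Assembly` (stmt-MatrixMultiplication-7542) — proved

The assembly item of route `MatrixMultiplication/ProbeRankScaling` (refutation line) is the
implication `HalfScaleBeat → ¬ MatrixMultiplication`: if for some `δ > 0` and infinitely many `n`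
every decomposition of `⟨n,n,n⟩` over `ℂ` all of whose probes have matrix rank `≤ √n` needs at
least `n^(5/2+δ)` terms, then `ω(ℂ) ≠ 2`.

Proof (pure logic, the scale-one-half threshold theorem of the thesis assembled from the tree):
the route file's deciding theorem
`closes : HalfScaleBeat → HalfScaleTransfer → SuperquadraticInfinitelyOften → ¬ MatrixMultiplication`
is fed the two supports already proved in the tree —
`halfScaleTransfer_proof` (recursion chord at scale one-half: Kronecker product of a rank-attaining
decomposition of `⟨⌊√n⌋⟩` with the schoolbook algorithm plus zero-padding turns the scale-`√n`
lower bound into `m^(2+δ) < R(⟨m,m,m⟩)` for infinitely many `m`) and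
`SuperquadraticInfinitelyOften_holds` (an infinitely-often superquadratic rank lower bound
contradicts `ω(ℂ) = 2`, `ω` being the infimum of the admissible exponents).

References: M. Bläser, *Fast Matrix Multiplication*, Theory of Computing Graduate Surveys 5 (2013),
§§4–5; V. Strassen, Gaussian elimination is not optimal, Numer. Math. 13 (1969).
-/

namespace Summit.MatrixMultiplication.MatrixMultiplication.Theorems

/-- **Assembly of route `ProbeRankScaling` (stmt-MatrixMultiplication-7542), exact signature
`HalfScaleBeat → ¬ MatrixMultiplication`.** The deciding theorem `closes` of the route file,
instantiated with the tree proofs of its two provable-now hypotheses `HalfScaleTransfer`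
(`halfScaleTransfer_proof`) and `SuperquadraticInfinitelyOften`
(`SuperquadraticInfinitelyOften_holds`). [folklore] -/
theorem probeRankScaling_assembly_proof :
    Summit.MatrixMultiplication.MatrixMultiplication.Theses.ProbeRankScaling.Assembly := by
  unfold Summit.MatrixMultiplication.MatrixMultiplication.Theses.ProbeRankScaling.Assembly
  intro hX
  exact Summit.MatrixMultiplication.MatrixMultiplication.Theses.ProbeRankScaling.closes hX
    halfScaleTransfer_proof
    Summit.MatrixMultiplication.MatrixMultiplication.Theses.ProbeRankScaling.SuperquadraticInfinitelyOften_holds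

end Summit.MatrixMultiplication.MatrixMultiplication.Theorems
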